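import Mathlib
import HarnessLib

/-!
# Magnen–Rivasseau–Sénéor, *Construction of YM₄ with an infrared cutoff* (CMP 155, 1993), Sect. V pp.358–360: the ALGEBRA of the
# inductive resolvent expansion AS PRINTED — (V.1) «1/(Δ + δ) = 1/Δ − (1/Δ)δ(1/(Δ + δ))» and its finite iteration, (V.4) the insertion
# of the two localisation partitions of unity around `(1/Δ⁰_B) Δ⁰_B (1/Δ⁰_B)`, (V.6) «one expansion step on the propagator», and the
# p.360 sentence «a difference B̄′_{l,Δ} − B̄′_{l,Δ″} which we can rewrite in terms of a gradient acting on B′_l times a length bounded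
# by the distance between Δ and Δ″» — PROVED as identities in an arbitrary ring and as the mean-value ∕ averaging inequality

non-commutative ring identities for invertible elements and first-year real analysis (mean value inequality, averages); nothing
here is a claim about the Yang–Mills mass gap, about continuum YM₄ on `T⁴` (with or without infrared cutoff), or about the Clay
problem — and nothing of the OPERATORS `Δ⁰_B`, `Δ⁰_Δ` of (V.3)–(V.5) (covariant Laplacians with background field, their domains,
inverses and kernels), of the error terms (V.7), of the stopping rules, of the small factors the expansion is designed to produce,
or of the convergence of anything is asserted or formalised: the file checks the LETTER of the displayed algebra

**Citation header (reproduction of PUBLISHED work).** J. Magnen, V. Rivasseau, R. Sénéor, *Construction of YM₄ with an infrared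
cutoff*, Commun. Math. Phys. **155** (1993) 325–383 [MagnenRivasseauSeneor1993], Sect. V «The Small Field Versus Large Field Expansion»,
(V.1) p.358, (V.4) ∕ (V.6) p.359, p.360 tl.6–8 and tl.22–23; (EDITION v1.1) (V.7) p.360 tl.2–5. Loci «p.NNN [PDF nn] tl.k» = journal page ∕ PDF
page (= journal page − 324) ∕ text-layer line (running head = tl.1) of
the held scan `paper:magnen1993-cmp155-mrs-ym4-infrared-cutoff`; the displays were read on the page images of record
`run/shared/lean/pub/lit-balaban/inprint/lit-balaban-p14/renders-cmp155/p34_full_s6.png`, `p35_full_s6.png`, `p36_full_s6.png` (the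
text layer garbles them; EDITION v1.2 states every locator as a text-layer line «tl.k», replacing v1's looser «lines» counts). Cell pub-balaban-gaps (YM blitz, track G3 «MRS 1993
typed AS PRINTED»), seat mrs-lit-2 (gen 18, file 52); companion record `run/shared/lean/pub/pub-balaban-gaps/g3/MRS-AS-PRINTED-estimates.md`
(§7: the displays (V.1), (V.3)–(V.13) were listed there as «NOT COVERED — definitions ∕ derivation steps»; this file covers (V.1), (V.4),
(V.6) at the level of their algebra). Mathlib only; no sibling is imported (the determinant inequalities (V.14)–(V.15) of the same
section are this seat's file 5 `MRS93DeterminantInequalities`). The resolvent identity itself is of course in the tree already in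
other letters (e.g. `…Balaban1983to89.B5.resolvent_identity`, Bałaban's (1.132)–(1.133) «G = G₀ + G₀xG»); what this file adds is
MRS's printed form (V.1) with its FINITE iteration and the (V.4) ∕ (V.6) localised one-step structure, stated for units of a ring.

**What the paper prints (verbatim, from the page images).**
* p.358 [PDF 34] tl.4–12: *«More precisely we define an inductive resolvent expansion. An ordinary resolvent expansion is of the
  type 1/(Δ + δ) = 1/Δ − (1/Δ) δ (1/(Δ + δ)). (V.1) In our case we imagine Δ to be a translation invariant propagator suited for a
  cluster expansion in the small field region such as (−Δ^{homothetic})^{−1}, and the perturbation δ contains the background field,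
  hence it is variable. Even inside the small field region we cannot iterate formula (V.1) infinitely many times because the
  background fields produced in δ could lead to factorials when bounded. Also in the large field region we must certainly keep this
  expansion in a resummed form»*.
* p.359 [PDF 35] (V.4): *«We write 1/Δ⁰_B (x, y) = Σ_j Σ_{Δ∈𝐃_j} Σ_{j′} Σ_{Δ′∈𝐃_{j′}} χ_Δ(x) κ^j (1/Δ⁰_B) Δ⁰_B (1/Δ⁰_B) κ^{j′} χ_{Δ′}(y).
  (V.4)»*; (V.5a)–(V.5b) introduce for each box `Δ` the constant-background operator `Δ⁰_Δ`; (V.6): *«One expansion step on the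
  propagator consists in writing 1/Δ⁰_B = Σ_{j,Δ∈𝐃_j} Σ_{j′,Δ′∈𝐃_{j′}} χ_Δ(x)κ^j (1/Δ⁰_B) Δ⁰_B (1/Δ⁰_B) κ^{j′}χ_{Δ′}(y) = Σ_{j,Δ∈𝐃_j}
  Σ_{j′,Δ′∈𝐃_{j′}} χ_Δ(x)κ^j (1/Δ⁰_Δ [1 + (Δ⁰_Δ − Δ⁰_B) 1/Δ⁰_B]) Δ⁰_B ([1/Δ⁰_B (Δ⁰_{Δ′} − Δ⁰_B) + 1] 1/Δ⁰_{Δ′}) κ^{j′}χ_{Δ′}(y).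
  (V.6)»*.
* p.360 [PDF 36] tl.6–8: *«For each box Δ″ ∈ CSFR_{j″}, j″ ≤ j + 10 we get a difference B̄′_{l,Δ} − B̄′_{l,Δ″} which we can rewrite
  in terms of a gradient acting on B′_l times a length bounded by the distance between Δ and Δ″.»*; tl.22–23: *«In the case where
  either one of these two terms is chosen in (V.7) the expansion step (V.6) is reiterated on 1/Δ⁰_B with Δ replaced by Δ″.»*
* (EDITION v1.1) **(V.7)** p.360 [PDF 36] tl.2–5 with its display (page image re-decoded at 2×,
  `run/shared/lean/pub/pub-balaban-gaps/pub-balaban-gaps-mrs-lit-2/g20/renders/p36_crop_r250-2300_s2.png`): *«Each difference of the type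
  (Δ⁰_Δ − Δ⁰_B) is then rewritten as (here for simplification we consider only the diagonal terms in δ_μν and neglect the terms
  proportional to ζ − 1 which are exactly similar): ( Σ_{j″≤j+10, Δ″∈𝐃_{j″}} (∇_{B̄′_{l,Δ}})_σ (κ^{j″})^{1/2} χ_{Δ″} (κ^{j″})^{1/2} (∇_{B̄′_{l,Δ}})_σ
  − Σ_{j″, Δ″∈𝐃_{j″}} (∇_{B̄′_{l,Δ″}})_σ (κ^{j″})^{1/2} χ_{Δ″} (κ^{j″})^{1/2} (∇_{B̄′_{l,Δ″}})_σ ). (V.7)»*; tl.18–20: *«In the difference (V.7)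
  there is also an error term (∇_{B̄′_{l,Δ″}})_σ (κ^{j″})^{1/2} χ_{Δ″} (κ^{j″})^{1/2} (∇_{B̄′_{l,Δ″}})_σ with j″ > j + 10.»* ((V.5a) p.359: the first
  term of `Δ⁰_Δ` is `(∇_{B̄′_{l,Δ}})_σ (κ̄^j) (∇_{B̄′_{l,Δ}})_σ` with «(κ̄^j) = Σ_{j′≤j+10} κ^{j′}»; (V.3a): the first term of `Δ⁰_{B,j″,Δ″}` is
  `(∇_{B̄′_{l,Δ″}})_σ (κ^{j″})^{1/2} χ_{Δ″} (κ^{j″})^{1/2} (∇_{B̄′_{l,Δ″}})_σ`, summed over all `j″, Δ″`.)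

**What is formalised (every statement below is a `theorem` with its proof; `R` any ring, inverses as units `Rˣ`).**
* §1 **`resolvent_identity`** ((V.1) exactly: `S⁻¹ = Δ⁻¹ − Δ⁻¹ δ S⁻¹` for units `Δ`, `S` with `S = Δ + δ`), `resolvent_identity'`
  (the mirror form `S⁻¹ = Δ⁻¹ − S⁻¹ δ Δ⁻¹`).
* §2 **`resolvent_iterate`**: for every `N`, `S⁻¹ = Σ_{n<N} (−Δ⁻¹δ)ⁿΔ⁻¹ + (−Δ⁻¹δ)^N S⁻¹` — (V.1) iterated finitely many times WITH
  its remainder («we cannot iterate formula (V.1) infinitely many times»: no series, no convergence claim).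
* §3 `inv_eq_sandwich` (`B⁻¹ = B⁻¹BB⁻¹`), `eq_sum_sum_of_partitions` (`X = Σ_aΣ_b P_a X Q_b` when `Σ_a P_a = 1 = Σ_b Q_b`, finite
  sums), **`displayV4`** ((V.4): `B⁻¹ = Σ_aΣ_b P_a (B⁻¹BB⁻¹) Q_b`).
* §4 `inv_eq_inv_mul_one_add` (`B⁻¹ = A⁻¹[1 + (A − B)B⁻¹]`), `inv_eq_add_one_mul_inv` (`B⁻¹ = [B⁻¹(A′ − B) + 1]A′⁻¹`),
  **`expansion_step`** (the summand of (V.6)), **`displayV6`** ((V.6) with box-dependent `A_a = Δ⁰_Δ`, `A′_b = Δ⁰_{Δ′}` and the two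
  partitions of unity), `left_steps_iterate` (reiterating the left step around the same `Δ⁰_Δ` `N` times = §2 with `δ = Δ⁰_B − Δ⁰_Δ`).
* §5 `abs_average_sub_average_le` (ANY measure space: if `|f(x) − f(y)| ≤ C` for `x ∈ S`, `y ∈ T`, cells of finite positive measure
  on which `f` is integrable, then `|(1/|S|)∫_S f − (1/|T|)∫_T f| ≤ C`), `abs_sub_le_of_fderiv_le` (mean value inequality on a convex
  set, Mathlib's `Convex.norm_image_sub_le_of_norm_fderiv_le`), **`abs_boxAverage_sub_le_grad_mul_dist`** (p.360 tl.6–8: with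
  `|∇f| ≤ G` on a convex region containing both boxes and `|x − y| ≤ D` across them, the box AVERAGES of `f` differ by at most `G·D`).
* §6 (EDITION v1.1) THE ALGEBRA OF (V.7), in any ring: `sandwich_kbar` (writing `(κ̄^j)` through the partition of unity:
  `X (Σ_{j″} s_{j″} (Σ_{Δ″} χ_{Δ″}) s_{j″}) X = Σ_{j″} Σ_{Δ″} X (s_{j″} χ_{Δ″} s_{j″}) X` when `Σ χ = 1` — how the first sum of (V.7) arises from
  (V.5a)), **`conj_sub_conj`** (`X K X − Y K Y = (X − Y) K X + Y K (X − Y)` — with `X = (∇_{B̄′_{l,Δ}})_σ`, `Y = (∇_{B̄′_{l,Δ″}})_σ` affine in the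
  background, `X − Y` is the insertion of the DIFFERENCE `B̄′_{l,Δ} − B̄′_{l,Δ″}`: «we get a difference B̄′_{l,Δ} − B̄′_{l,Δ″}»), **`displayV7`**
  (the printed difference of sums, the first over the «near» indices `j″ ≤ j + 10` only, the second over all: = Σ_{near} [(X − Y_a) K_a X +
  Y_a K_a (X − Y_a)] − Σ_{far} Y_a K_a Y_a — every near term carries the difference, the far terms `j″ > j + 10` are the «error term» of
  tl.18–20), for an arbitrary finite index set with a decidable «near» predicate.

**EDITION v1.1 (same seat, gen 20; ADD-ONLY — every v1 declaration byte-identical, no import change):** §6 = the algebra of the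
error-term display (V.7) p.360 (see above); the v1 sentence «the error terms (V.7) … [not claimed]» below now reads: the SMALL FACTORS
of the error terms ((II.29a–c), momentum conservation) are not claimed — their algebraic form is §6. Companion: this seat's file 56
`MRS93DecouplingInterpolation` ((V.8), (V.9), (V.12) and the positivity sentences of pp.361∕363).

**EDITION v1.2 (same seat, gen 20; DOCSTRINGS ONLY — every declaration of v1.1 byte-identical, no import change):** all page
locators restated as TEXT-LAYER line numbers «tl.k» (running head = tl.1): p.358 «More precisely … resummed form» tl.4–12; p.360 «Each
difference … (V.7)» tl.2–5, «For each box Δ″ … distance between Δ and Δ″» tl.6–8, «In the difference (V.7) there is also an error term …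
j″ > j + 10» tl.18–20, «In the case where either one of these two terms is chosen in (V.7) the expansion step (V.6) is reiterated» tl.22–23
(v1 printed «lines 19–20», v1.1 «lines 13–15» for the error-term sentence — both loose). Nothing else moves.

**Reading conventions.** (i) «1/Δ», «1/(Δ + δ)», «1/Δ⁰_B», «1/Δ⁰_Δ» are typed as INVERSES OF UNITS of an abstract ring `R` (the ring
of operators in which MRS compute); that the printed operators are invertible on the relevant spaces is the paper's standing
assumption in Sect. V and a HYPOTHESIS here (membership in `Rˣ`), never derived. (ii) The localisations `χ_Δ(x)κ^j` (left) and
`κ^{j′}χ_{Δ′}(y)` (right) of (V.4) are abstract ring elements `P_a`, `Q_b` indexed by finite sets, with `Σ_a P_a = 1 = Σ_b Q_b` as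
hypotheses (in the paper: `Σ_jκ^j = ` the cutoff and `Σ_Δχ_Δ = 1` — partitions of unity up to the fixed cutoffs; the identity is used
between cut-off fields, where they act as `1`). (iii) «B̄′_{l,Δ}» = the AVERAGE of the field over the box ((II.26)-type `(1/Δ)∫_Δ`),
typed as `(μ Δ)⁻¹∫_Δ f dμ` for any measure; «a gradient acting on B′_l» ↦ a bound `G` on `‖fderiv ℝ f‖` over a convex region
containing both boxes; «a length bounded by the distance between Δ and Δ″» ↦ any `D` with `|x − y| ≤ D` for `x ∈ Δ`, `y ∈ Δ″`
(the largest distance; the printed «distance between Δ and Δ″» plus the two diameters would do). (iv) Scalar-valued `f` (one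
component `(B′_l)_μ^a` at a time).

**What is NOT claimed.** The operators (V.3a)–(V.5b) themselves, their invertibility, positivity or kernels; (V.2) (typed with (A.29)
in `MRS93HomotheticSliceDecay`); the SMALL FACTORS of the error terms (V.7) («(II.29a–c)», momentum conservation; their algebra is §6 since
EDITION v1.1); the stopping
rules (five error terms; ELFR couplings); (V.8)–(V.13) (file 56 has (V.8), (V.9), (V.12)); that any iteration converges or is summable; Lemma II.1; anything of
Bałaban's papers. MRS work at FIXED INFRARED CUTOFF: nothing here bears on infinite volume or a mass gap.
-/

noncomputable section

open Finset MeasureTheory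

namespace Literature.MathematicalPhysics.QuantumFieldTheory.MagnenRivasseauSeneor1993

namespace ResolventExpansion

/-! ## §1 (V.1) «1/(Δ + δ) = 1/Δ − (1/Δ) δ (1/(Δ + δ))» -/

section Algebra

variable {R : Type*} [Ring R]

/-- **(V.1)** p.358 [PDF 34]: *«An ordinary resolvent expansion is of the type 1/(Δ + δ) = 1/Δ − (1/Δ) δ (1/(Δ + δ)). (V.1)»* — in any
ring, for `Δ` and `S = Δ + δ` invertible (non-commutative: the order of the factors is the printed one).
[cite: MagnenRivasseauSeneor1993, Sect. V (V.1) p.358] -/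
theorem resolvent_identity (Δ S : Rˣ) (δ : R) (hS : (S : R) = Δ + δ) :
    (↑S⁻¹ : R) = ↑Δ⁻¹ - ↑Δ⁻¹ * δ * ↑S⁻¹ := by
  have h1 : (Δ : R) = S - δ := by rw [hS, add_sub_cancel_right]
  symm
  calc (↑Δ⁻¹ : R) - ↑Δ⁻¹ * δ * ↑S⁻¹ = ↑Δ⁻¹ * ((S : R) - δ) * ↑S⁻¹ := by
        rw [mul_sub, sub_mul, mul_assoc (↑Δ⁻¹ : R) (S : R), Units.mul_inv, mul_one]
    _ = ↑S⁻¹ := by rw [← h1, Units.inv_mul, one_mul]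

/-- (V.1) with the perturbation on the other side: `1/(Δ + δ) = 1/Δ − (1/(Δ + δ)) δ (1/Δ)`.
[cite: MagnenRivasseauSeneor1993, Sect. V (V.1) p.358] -/
theorem resolvent_identity' (Δ S : Rˣ) (δ : R) (hS : (S : R) = Δ + δ) :
    (↑S⁻¹ : R) = ↑Δ⁻¹ - ↑S⁻¹ * δ * ↑Δ⁻¹ := by
  have h1 : (Δ : R) = S - δ := by rw [hS, add_sub_cancel_right]
  symm
  calc (↑Δ⁻¹ : R) - ↑S⁻¹ * δ * ↑Δ⁻¹ = ↑S⁻¹ * ((S : R) - δ) * ↑Δ⁻¹ := by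
        rw [mul_sub, sub_mul, Units.inv_mul, one_mul]
    _ = ↑S⁻¹ := by rw [← h1, mul_assoc, Units.mul_inv, mul_one]

/-! ## §2 «we cannot iterate formula (V.1) infinitely many times» (p.358 tl.8–9): the FINITE iteration, to any order `N`, with
its remainder -/

/-- **(V.1) iterated `N` times**: `1/(Δ + δ) = Σ_{n<N} (−Δ⁻¹δ)ⁿ Δ⁻¹ + (−Δ⁻¹δ)^N · 1/(Δ + δ)` — an IDENTITY for every `N` (no
convergence statement: the paper iterates finitely many times and keeps the remainder, «in a resummed form»).
[cite: MagnenRivasseauSeneor1993, Sect. V (V.1) p.358 tl.5–12] -/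
theorem resolvent_iterate (Δ S : Rˣ) (δ : R) (hS : (S : R) = Δ + δ) (N : ℕ) :
    (↑S⁻¹ : R) = (∑ n ∈ range N, (-(↑Δ⁻¹ * δ)) ^ n * ↑Δ⁻¹) + (-(↑Δ⁻¹ * δ)) ^ N * ↑S⁻¹ := by
  induction N with
  | zero => simp
  | succ N ih =>
    have hstep : (-(↑Δ⁻¹ * δ)) ^ N * (↑S⁻¹ : R) =
        (-(↑Δ⁻¹ * δ)) ^ N * ↑Δ⁻¹ + (-(↑Δ⁻¹ * δ)) ^ (N + 1) * ↑S⁻¹ := by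
      conv_lhs => rw [resolvent_identity Δ S δ hS]
      rw [pow_succ, mul_sub, mul_assoc, mul_assoc, neg_mul, mul_neg, sub_eq_add_neg, mul_assoc]
    rw [sum_range_succ, add_assoc, ← hstep, ← ih]

/-! ## §3 (V.4) «1/Δ⁰_B (x, y) = Σ_j Σ_{Δ∈𝐃_j} Σ_{j′} Σ_{Δ′∈𝐃_{j′}} χ_Δ(x) κ^j (1/Δ⁰_B) Δ⁰_B (1/Δ⁰_B) κ^{j′} χ_Δ′(y)»: inserting the two
partitions of unity and the sandwich `B⁻¹ = B⁻¹ B B⁻¹` -/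

/-- `1/Δ_B = (1/Δ_B) Δ_B (1/Δ_B)`. [cite: MagnenRivasseauSeneor1993, Sect. V (V.4) p.359] -/
theorem inv_eq_sandwich (B : Rˣ) : (↑B⁻¹ : R) = ↑B⁻¹ * (B : R) * ↑B⁻¹ := by
  rw [Units.inv_mul, one_mul]

/-- Inserting two finite partitions of unity `Σ_a P_a = 1` (left) and `Σ_b Q_b = 1` (right) around any element:
`X = Σ_a Σ_b P_a X Q_b`. [cite: MagnenRivasseauSeneor1993, Sect. V (V.4) p.359] -/
theorem eq_sum_sum_of_partitions {ι κ : Type*} (s : Finset ι) (t : Finset κ) (P : ι → R) (Q : κ → R) (X : R)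
    (hP : ∑ a ∈ s, P a = 1) (hQ : ∑ b ∈ t, Q b = 1) :
    X = ∑ a ∈ s, ∑ b ∈ t, P a * X * Q b := by
  have h : (∑ a ∈ s, P a) * X * ∑ b ∈ t, Q b = ∑ a ∈ s, ∑ b ∈ t, P a * X * Q b := by
    rw [sum_mul, sum_mul]
    exact sum_congr rfl fun a _ => mul_sum t (fun b => Q b) (P a * X)
  rw [← h, hP, hQ, one_mul, mul_one]

/-- **(V.4)** p.359 [PDF 35]: *«We write 1/Δ⁰_B (x, y) = Σ_j Σ_{Δ∈𝐃_j} Σ_{j′} Σ_{Δ′∈𝐃_{j′}} χ_Δ(x)κ^j (1/Δ⁰_B) Δ⁰_B (1/Δ⁰_B)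
κ^{j′}χ_{Δ′}(y). (V.4)»* — the algebraic content: with the localisations `P_a = χ_Δκ^j` summing to `1` on the left and `Q_b =
κ^{j′}χ_{Δ′}` summing to `1` on the right (indices `a = (j, Δ)`, `b = (j′, Δ′)` in finite sets), `B⁻¹ = Σ_a Σ_b P_a (B⁻¹ B B⁻¹) Q_b`.
[cite: MagnenRivasseauSeneor1993, Sect. V (V.4) p.359] -/
theorem displayV4 {ι κ : Type*} (s : Finset ι) (t : Finset κ) (P : ι → R) (Q : κ → R) (B : Rˣ)
    (hP : ∑ a ∈ s, P a = 1) (hQ : ∑ b ∈ t, Q b = 1) :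
    (↑B⁻¹ : R) = ∑ a ∈ s, ∑ b ∈ t, P a * (↑B⁻¹ * (B : R) * ↑B⁻¹) * Q b := by
  rw [← inv_eq_sandwich]
  exact eq_sum_sum_of_partitions s t P Q _ hP hQ

/-! ## §4 (V.6) «One expansion step on the propagator»: `1/Δ_B = (1/Δ_Δ)[1 + (Δ_Δ − Δ_B)(1/Δ_B)]` on the left,
`1/Δ_B = [(1/Δ_B)(Δ_{Δ′} − Δ_B) + 1](1/Δ_{Δ′})` on the right -/

/-- Left step: `1/Δ_B = (1/Δ_Δ)[1 + (Δ_Δ − Δ_B)(1/Δ_B)]` for `Δ_Δ`, `Δ_B` invertible.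
[cite: MagnenRivasseauSeneor1993, Sect. V (V.6) p.359] -/
theorem inv_eq_inv_mul_one_add (A B : Rˣ) : (↑B⁻¹ : R) = ↑A⁻¹ * (1 + ((A : R) - B) * ↑B⁻¹) := by
  rw [mul_add, mul_one, sub_mul, Units.mul_inv, mul_sub, ← mul_assoc, Units.inv_mul, one_mul, mul_one,
    add_sub_cancel]

/-- Right step: `1/Δ_B = [(1/Δ_B)(Δ_{Δ′} − Δ_B) + 1](1/Δ_{Δ′})`. [cite: MagnenRivasseauSeneor1993, Sect. V (V.6) p.359] -/
theorem inv_eq_add_one_mul_inv (A' B : Rˣ) : (↑B⁻¹ : R) = (↑B⁻¹ * ((A' : R) - B) + 1) * ↑A'⁻¹ := by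
  rw [add_mul, one_mul, mul_sub, Units.inv_mul, sub_mul, mul_assoc, Units.mul_inv, mul_one, one_mul,
    sub_add_cancel]

/-- **(V.6), one term**: `(1/Δ_B) Δ_B (1/Δ_B) = (1/Δ_Δ [1 + (Δ_Δ − Δ_B) 1/Δ_B]) Δ_B ([1/Δ_B (Δ_{Δ′} − Δ_B) + 1] 1/Δ_{Δ′})` — both
outer inverses of the sandwich expanded once, the left one around `Δ_Δ`, the right one around `Δ_{Δ′}`.
[cite: MagnenRivasseauSeneor1993, Sect. V (V.6) p.359] -/
theorem expansion_step (A A' B : Rˣ) :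
    ↑B⁻¹ * (B : R) * ↑B⁻¹ =
      (↑A⁻¹ * (1 + ((A : R) - B) * ↑B⁻¹)) * (B : R) * ((↑B⁻¹ * ((A' : R) - B) + 1) * ↑A'⁻¹) := by
  rw [← inv_eq_inv_mul_one_add A B, ← inv_eq_add_one_mul_inv A' B]

/-- **(V.6)** p.359 [PDF 35], verbatim: *«One expansion step on the propagator consists in writing 1/Δ⁰_B = Σ_{j,Δ∈𝐃_j}
Σ_{j′,Δ′∈𝐃_{j′}} χ_Δ(x)κ^j (1/Δ⁰_B) Δ⁰_B (1/Δ⁰_B) κ^{j′}χ_{Δ′}(y) = Σ_{j,Δ∈𝐃_j} Σ_{j′,Δ′∈𝐃_{j′}} χ_Δ(x)κ^j (1/Δ⁰_Δ [1 + (Δ⁰_Δ −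
Δ⁰_B) 1/Δ⁰_B]) Δ⁰_B ([1/Δ⁰_B (Δ⁰_{Δ′} − Δ⁰_B) + 1] 1/Δ⁰_{Δ′}) κ^{j′}χ_{Δ′}(y). (V.6)»* — the algebraic content, with the
box-dependent constant-background operators `A_a = Δ⁰_Δ`, `A′_b = Δ⁰_{Δ′}` ((V.5a/b)) all invertible and the localisations
summing to one on each side. [cite: MagnenRivasseauSeneor1993, Sect. V (V.6) p.359; (V.5a)–(V.5b) p.359] -/
theorem displayV6 {ι κ : Type*} (s : Finset ι) (t : Finset κ) (P : ι → R) (Q : κ → R) (A : ι → Rˣ) (A' : κ → Rˣ)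
    (B : Rˣ) (hP : ∑ a ∈ s, P a = 1) (hQ : ∑ b ∈ t, Q b = 1) :
    (↑B⁻¹ : R) = ∑ a ∈ s, ∑ b ∈ t,
      P a * ((↑(A a)⁻¹ * (1 + ((A a : R) - B) * ↑B⁻¹)) * (B : R) * ((↑B⁻¹ * ((A' b : R) - B) + 1) * ↑(A' b)⁻¹)) * Q b := by
  refine (displayV4 s t P Q B hP hQ).trans (sum_congr rfl fun a _ => sum_congr rfl fun b _ => ?_)
  rw [expansion_step (A a) (A' b) B]

/-- «In the case where either one of these two terms is chosen in (V.7) the expansion step (V.6) is reiterated on 1/Δ⁰_B» (p.360):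
the factor `1/Δ_B` that survives inside each step is again of the form to which `inv_eq_inv_mul_one_add` applies — after `N`
left steps around the SAME `Δ_Δ` one has the finite Neumann-type identity of §2 with `δ = Δ_B − Δ_Δ`.
[cite: MagnenRivasseauSeneor1993, Sect. V (V.6) p.359, p.360 tl.22–23] -/
theorem left_steps_iterate (A B : Rˣ) (N : ℕ) :
    (↑B⁻¹ : R) = (∑ n ∈ range N, (-(↑A⁻¹ * ((B : R) - A))) ^ n * ↑A⁻¹) + (-(↑A⁻¹ * ((B : R) - A))) ^ N * ↑B⁻¹ :=
  resolvent_iterate A B ((B : R) - A) (by rw [add_sub_cancel]) N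

end Algebra

/-! ## §5 p.360 tl.6–8: «For each box Δ″ ∈ CSFR_{j″}, j″ ≤ j + 10 we get a difference B̄′_{l,Δ} − B̄′_{l,Δ″} which we can rewrite
in terms of a gradient acting on B′_l times a length bounded by the distance between Δ and Δ″» -/

section Average


/-- Averaging a two-point bound: if `|f(x) − f(y)| ≤ C` for all `x ∈ S`, `y ∈ T` (cells of finite positive measure, `f` integrable on
both), then the AVERAGES differ by at most `C`: `|(1/|S|)∫_S f − (1/|T|)∫_T f| ≤ C` (the fields `B̄′_{l,Δ}` are box averages, (II.26) ∕
Sect. IV). [cite: MagnenRivasseauSeneor1993, Sect. V p.360 tl.6–8; §II.B (II.26) p.335] -/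
theorem abs_average_sub_average_le {Ω : Type*} [MeasurableSpace Ω] {μ : Measure Ω} {f : Ω → ℝ} {S T : Set Ω} {C : ℝ}
    (hS0 : μ S ≠ 0) (hS : μ S < ⊤) (hT0 : μ T ≠ 0) (hT : μ T < ⊤)
    (hfS : IntegrableOn f S μ) (hfT : IntegrableOn f T μ)
    (hC : ∀ x ∈ S, ∀ y ∈ T, |f x - f y| ≤ C) :
    |(μ.real S)⁻¹ * ∫ x in S, f x ∂μ - (μ.real T)⁻¹ * ∫ y in T, f y ∂μ| ≤ C := by
  have hSr : 0 < μ.real S := ENNReal.toReal_pos hS0 hS.ne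
  have hTr : 0 < μ.real T := ENNReal.toReal_pos hT0 hT.ne
  set a : ℝ := (μ.real T)⁻¹ * ∫ y in T, f y ∂μ with ha
  -- step 1: for x ∈ S, |f x − a| ≤ C
  have h1 : ∀ x ∈ S, |f x - a| ≤ C := by
    intro x hx
    have hint : ∫ y in T, (f x - f y) ∂μ = f x * μ.real T - ∫ y in T, f y ∂μ := by
      have hc : IntegrableOn (fun _ : Ω => f x) T μ := integrableOn_const (C := f x) hT.ne
      rw [integral_sub hc hfT, setIntegral_const, smul_eq_mul, mul_comm]
    have hb := norm_setIntegral_le_of_norm_le_const hT (fun y hy => (Real.norm_eq_abs _).le.trans (hC x hx y hy))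
    rw [hint, Real.norm_eq_abs] at hb
    have hx' : f x - a = (μ.real T)⁻¹ * (f x * μ.real T - ∫ y in T, f y ∂μ) := by
      rw [ha]; field_simp
    rw [hx', abs_mul, abs_inv, abs_of_pos hTr]
    calc (μ.real T)⁻¹ * |f x * μ.real T - ∫ y in T, f y ∂μ| ≤ (μ.real T)⁻¹ * (C * μ.real T) :=
          mul_le_mul_of_nonneg_left hb (by positivity)
      _ = C := by field_simp
  -- step 2: average over S
  have hint2 : ∫ x in S, (f x - a) ∂μ = (∫ x in S, f x ∂μ) - a * μ.real S := by
    have hc : IntegrableOn (fun _ : Ω => a) S μ := integrableOn_const (C := a) hS.ne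
    rw [integral_sub hfS hc, setIntegral_const, smul_eq_mul, mul_comm]
  have hb2 := norm_setIntegral_le_of_norm_le_const hS (fun x hx => (Real.norm_eq_abs _).le.trans (h1 x hx))
  rw [hint2, Real.norm_eq_abs] at hb2
  have hrew : (μ.real S)⁻¹ * (∫ x in S, f x ∂μ) - a = (μ.real S)⁻¹ * ((∫ x in S, f x ∂μ) - a * μ.real S) := by
    field_simp
  rw [hrew, abs_mul, abs_inv, abs_of_pos hSr]
  calc (μ.real S)⁻¹ * |(∫ x in S, f x ∂μ) - a * μ.real S| ≤ (μ.real S)⁻¹ * (C * μ.real S) :=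
        mul_le_mul_of_nonneg_left hb2 (by positivity)
    _ = C := by field_simp

end Average

section Gradient

variable {E : Type*} [NormedAddCommGroup E] [NormedSpace ℝ E]

/-- The mean value inequality behind the sentence: on a convex set `s` where `|∇f| ≤ G`, for `x ∈ Δ ⊆ s`, `y ∈ Δ″ ⊆ s` at distance
`|x − y| ≤ D`: `|f(x) − f(y)| ≤ G·D` («a gradient acting on B′_l times a length»).
[cite: MagnenRivasseauSeneor1993, Sect. V p.360 tl.6–8] -/
theorem abs_sub_le_of_fderiv_le {f : E → ℝ} {s : Set E} (hs : Convex ℝ s) {G D : ℝ}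
    (hf : ∀ x ∈ s, DifferentiableAt ℝ f x) (hG : ∀ x ∈ s, ‖fderiv ℝ f x‖ ≤ G) (hG0 : 0 ≤ G)
    {x y : E} (hx : x ∈ s) (hy : y ∈ s) (hD : ‖x - y‖ ≤ D) : |f x - f y| ≤ G * D := by
  have h := hs.norm_image_sub_le_of_norm_fderiv_le hf hG hy hx
  rw [Real.norm_eq_abs] at h
  exact h.trans (mul_le_mul_of_nonneg_left hD hG0)

variable [MeasurableSpace E]

/-- **p.360 tl.6–8 as a theorem**: for a field `f = B′_l` differentiable on a convex region `s` containing the two boxes `Δ`, `Δ″`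
with `|∇f| ≤ G` there, and `|x − y| ≤ D` for `x ∈ Δ`, `y ∈ Δ″` («a length bounded by the distance between Δ and Δ″», here the
largest one), the box averages satisfy `|f̄_Δ − f̄_{Δ″}| ≤ G·D`. [cite: MagnenRivasseauSeneor1993, Sect. V p.360 tl.6–8] -/
theorem abs_boxAverage_sub_le_grad_mul_dist {μ : Measure E} {f : E → ℝ} {s Δ Δ'' : Set E} {G D : ℝ}
    (hs : Convex ℝ s) (hΔ : Δ ⊆ s) (hΔ'' : Δ'' ⊆ s)
    (hf : ∀ x ∈ s, DifferentiableAt ℝ f x) (hG : ∀ x ∈ s, ‖fderiv ℝ f x‖ ≤ G) (hG0 : 0 ≤ G)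
    (hD : ∀ x ∈ Δ, ∀ y ∈ Δ'', ‖x - y‖ ≤ D)
    (hΔ0 : μ Δ ≠ 0) (hΔt : μ Δ < ⊤) (hΔ''0 : μ Δ'' ≠ 0) (hΔ''t : μ Δ'' < ⊤)
    (hfΔ : IntegrableOn f Δ μ) (hfΔ'' : IntegrableOn f Δ'' μ) :
    |(μ.real Δ)⁻¹ * ∫ x in Δ, f x ∂μ - (μ.real Δ'')⁻¹ * ∫ y in Δ'', f y ∂μ| ≤ G * D :=
  abs_average_sub_average_le hΔ0 hΔt hΔ''0 hΔ''t hfΔ hfΔ''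
    (fun x hx y hy => abs_sub_le_of_fderiv_le hs hf hG hG0 (hΔ hx) (hΔ'' hy) (hD x hx y hy))

end Gradient

/-! ## §6 (EDITION v1.1) (V.7) «Each difference of the type (Δ⁰_Δ − Δ⁰_B) is then rewritten as …»: its algebra, in any ring -/

section DisplayV7

variable {R : Type*} [Ring R]

/-- How the first sum of (V.7) arises from (V.5a): with «(κ̄^j) = Σ_{j′≤j+10} κ̄^{j′}» written through square roots and the partition of
unity `Σ_{Δ″} χ_{Δ″} = 1`, `X (Σ_{j″} s_{j″} (Σ_{Δ″} χ_{Δ″}) s_{j″}) X = Σ_{j″} Σ_{Δ″} X (s_{j″} χ_{Δ″} s_{j″}) X` — finite sums in any ring.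
[cite: MagnenRivasseauSeneor1993, Sect. V (V.5a) p.359, (V.7) p.360] -/
theorem sandwich_kbar {ι κ : Type*} (J : Finset ι) (D : Finset κ) (sq : ι → R) (χ : κ → R) (X : R) (hχ : ∑ b ∈ D, χ b = 1) :
    X * (∑ j ∈ J, sq j * sq j) * X = ∑ j ∈ J, ∑ b ∈ D, X * (sq j * χ b * sq j) * X := by
  have h : ∀ j ∈ J, sq j * sq j = ∑ b ∈ D, sq j * χ b * sq j := fun j _ => by
    rw [← Finset.sum_mul, ← Finset.mul_sum, hχ, mul_one]
  rw [Finset.sum_congr rfl h, Finset.mul_sum, Finset.sum_mul]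
  refine Finset.sum_congr rfl fun j _ => ?_
  rw [Finset.mul_sum, Finset.sum_mul]

/-- **«we get a difference B̄′_{l,Δ} − B̄′_{l,Δ″}»** (p.360 tl.6), the algebra: `X K X − Y K Y = (X − Y) K X + Y K (X − Y)` in any
ring — with `X = (∇_{B̄′_{l,Δ}})_σ`, `Y = (∇_{B̄′_{l,Δ″}})_σ` (covariant derivatives, AFFINE in the background) and
`K = (κ^{j″})^{1/2} χ_{Δ″} (κ^{j″})^{1/2}`, each paired term of (V.7) is linear in the insertion `X − Y` of the difference of the two
averaged background fields. [cite: MagnenRivasseauSeneor1993, Sect. V (V.7) p.360 tl.2–8] -/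
theorem conj_sub_conj (X Y K : R) : X * K * X - Y * K * Y = (X - Y) * K * X + Y * K * (X - Y) := by
  simp only [sub_mul, mul_sub]
  abel

/-- **(V.7)** p.360 [PDF 36]: *«( Σ_{j″≤j+10, Δ″∈𝐃_{j″}} (∇_{B̄′_{l,Δ}})_σ (κ^{j″})^{1/2} χ_{Δ″} (κ^{j″})^{1/2} (∇_{B̄′_{l,Δ}})_σ − Σ_{j″, Δ″∈𝐃_{j″}}
(∇_{B̄′_{l,Δ″}})_σ (κ^{j″})^{1/2} χ_{Δ″} (κ^{j″})^{1/2} (∇_{B̄′_{l,Δ″}})_σ ) (V.7)»* with tl.6–8 and tl.18–20 — PROVED as an identity in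
any ring, for any finite index set `s` of pairs `a = (j″, Δ″)` with the «near» ones (`j″ ≤ j + 10`) selected by a decidable predicate
`p`, `X = (∇_{B̄′_{l,Δ}})_σ`, `Y_a = (∇_{B̄′_{l,Δ″}})_σ`, `K_a = (κ^{j″})^{1/2} χ_{Δ″} (κ^{j″})^{1/2}`: the printed difference equals
`Σ_{near} [(X − Y_a) K_a X + Y_a K_a (X − Y_a)] − Σ_{far} Y_a K_a Y_a` — every near term carries a difference `B̄′_{l,Δ} − B̄′_{l,Δ″}`
(«For each box Δ″ ∈ CSFR_{j″}, j″ ≤ j + 10 we get a difference»), the far terms are «the error term … with j″ > j + 10». The small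
factors these terms «deliver» ((II.29a–c), momentum conservation) are NOT formalised.
[cite: MagnenRivasseauSeneor1993, Sect. V (V.7) p.360 tl.2–21] -/
theorem displayV7 {ι : Type*} (s : Finset ι) (p : ι → Prop) [DecidablePred p] (X : R) (Y K : ι → R) :
    (∑ a ∈ s.filter p, X * K a * X) - (∑ a ∈ s, Y a * K a * Y a) =
      (∑ a ∈ s.filter p, ((X - Y a) * K a * X + Y a * K a * (X - Y a))) -
        ∑ a ∈ s.filter (fun a => ¬p a), Y a * K a * Y a := by
  rw [← Finset.sum_filter_add_sum_filter_not s p (fun a => Y a * K a * Y a)]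
  have h : ∑ a ∈ s.filter p, ((X - Y a) * K a * X + Y a * K a * (X - Y a)) =
      ∑ a ∈ s.filter p, (X * K a * X - Y a * K a * Y a) :=
    Finset.sum_congr rfl fun a _ => (conj_sub_conj X (Y a) (K a)).symm
  rw [h, Finset.sum_sub_distrib]
  abel

/-- The two pieces of (V.7) by name: the «near» part is a sum of terms LINEAR in the differences `X − Y_a`, and vanishes when all
the averaged backgrounds agree (`Y_a = X` for every near `a`). [cite: MagnenRivasseauSeneor1993, Sect. V (V.7) p.360 tl.6–8] -/
theorem displayV7_near_eq_zero_of_eq {ι : Type*} (s : Finset ι) (p : ι → Prop) [DecidablePred p] (X : R) (Y K : ι → R)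
    (hY : ∀ a ∈ s.filter p, Y a = X) :
    ∑ a ∈ s.filter p, ((X - Y a) * K a * X + Y a * K a * (X - Y a)) = 0 :=
  Finset.sum_eq_zero fun a ha => by rw [hY a ha, sub_self, zero_mul, zero_mul, mul_zero, add_zero]

end DisplayV7

end ResolventExpansion

end Literature.MathematicalPhysics.QuantumFieldTheory.MagnenRivasseauSeneor1993
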